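import Summits.HodgeConjecture.HodgeConjecture.Theses.KugaSatakeSaturation

/-!
# Crux `TwistAbsorption` (stmt-HodgeConjecture-17603) — line `zarhin_dichotomy` (birth skeleton)

`TwistAbsorption`: for an irreducible polarized K3-type `(T,H,P)` and every Hodge endomorphism
`e ∈ E = End_Hdg(T)`, the twisted Kuga–Satake embedding `κ ∘ e = (t ↦ L_{ι(e t)})` lies in
`N = span_ℚ {t ↦ b ∘ L_{ι t} ∘ b' | b, b' ∈ 𝔅 = End_Hdg(KS~)}`.

Line: Zarhin's dichotomy (tree `Zarhin1983_adjoint_eq_conj_holds`): `E` totally real with the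
`P`-adjoint involution `= id`, or CM with `' =` complex conjugation; the two cases are absorbed by two
different families of elements of `𝔅`:
* `stub_absorption_real` — real multiplication: partial volume elements `η_S` (`S ⊆` real places of
  `E`, over `E^{gal}`), `L_{η_S} ∈ 𝔅`, `L_{η_S} L_t L_{η_S}⁻¹ = Σ_σ ±(−1)^{[σ∈S]} L_{π_σ t}`, the
  sign-character matrix is invertible; `E = ℚ` is the trivial sub-case;
* `stub_absorption_cm` — complex multiplication: degree projectors `p_k` of the spinor module,
  `L_{p_k} ∈ 𝔅_{ℚ̄}`, `Σ_k L_{p_{k+1}} L_t L_{p_k} = L_{π_ρ t}`; units by Skolem–Noether.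
Gate shape: stub statements = local defs `AbsorptionReal`, `AbsorptionCM`; `sorry` only in the two
`stub_*`; `twistAbsorption_of_pieces` sorry-free (verbatim conclusion); `TwistAbsorption_of :
TwistAbsorption` by name. (Same two stubs as A1/A2 of the parent line `Saturation/Lines/twist_split`.)
-/

set_option linter.dupNamespace false

namespace Summit.HodgeConjecture.HodgeConjecture.Cruxes.TwistAbsorption.ZarhinDichotomy

open Literature.AlgebraicGeometry.Motives
open Summit.HodgeConjecture.HodgeConjecture.Theses.KugaSatakeSaturation

/-- A1 — real-multiplication case. [cite: VanGeemen2008RM, §5–6] [cite: Zarhin1983HodgeGroupsK3, Thm. 2.2.1] -/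
def AbsorptionReal : Prop :=
  ∀ (T : Type) [AddCommGroup T] [Module ℚ T] [Module.Finite ℚ T] (H : HodgeStructure T 2) (P : H.Polarization), H.F 3 = ⊥ → H.hodgeNumber 2 0 = 1 → (∀ t : T, HodgeStructure.ofRat t ∈ H.F 1 → t = 0) → (∀ a : H.Hom H, LinearMap.IsAdjointPair P.form P.form a.toLinearMap a.toLinearMap) → ∀ e : H.Hom H, (LinearMap.mul ℚ (CliffordAlgebra (LinearMap.BilinMap.toQuadraticMap P.form))).comp ((CliffordAlgebra.ι (LinearMap.BilinMap.toQuadraticMap P.form)).comp e.toLinearMap) ∈ Submodule.span ℚ {ν : T →ₗ[ℚ] Module.End ℚ (CliffordAlgebra (LinearMap.BilinMap.toQuadraticMap P.form)) | ∃ b b' : Module.End ℚ (CliffordAlgebra (LinearMap.BilinMap.toQuadraticMap P.form)), (Submodule.map ((CliffordAlgebra.ι (LinearMap.BilinMap.toQuadraticMap P.form)).baseChange ℂ) (H.piece 2 0) * ⊤).map (b.baseChange ℂ) ≤ (Submodule.map ((CliffordAlgebra.ι (LinearMap.BilinMap.toQuadraticMap P.form)).baseChange ℂ) (H.piece 2 0)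 * ⊤) ∧ (Submodule.map ((CliffordAlgebra.ι (LinearMap.BilinMap.toQuadraticMap P.form)).baseChange ℂ) (H.piece 2 0) * ⊤).map (b'.baseChange ℂ) ≤ (Submodule.map ((CliffordAlgebra.ι (LinearMap.BilinMap.toQuadraticMap P.form)).baseChange ℂ) (H.piece 2 0) * ⊤) ∧ ∀ t, ν t = b ∘ₗ LinearMap.mulLeft ℚ ((CliffordAlgebra.ι (LinearMap.BilinMap.toQuadraticMap P.form)) t) ∘ₗ b'}

/-- A2 — complex-multiplication case. [cite: vanGeemen2000KugaSatakeHC, §6] [cite: Zarhin1983HodgeGroupsK3, Thm. 2.3.1] -/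
def AbsorptionCM : Prop :=
  ∀ (T : Type) [AddCommGroup T] [Module ℚ T] [Module.Finite ℚ T] (H : HodgeStructure T 2) (P : H.Polarization), H.F 3 = ⊥ → H.hodgeNumber 2 0 = 1 → (∀ t : T, HodgeStructure.ofRat t ∈ H.F 1 → t = 0) → (∃ a : H.Hom H, ¬ LinearMap.IsAdjointPair P.form P.form a.toLinearMap a.toLinearMap) → ∀ e : H.Hom H, (LinearMap.mul ℚ (CliffordAlgebra (LinearMap.BilinMap.toQuadraticMap P.form))).comp ((CliffordAlgebra.ι (LinearMap.BilinMap.toQuadraticMap P.form)).comp e.toLinearMap) ∈ Submodule.span ℚ {ν : T →ₗ[ℚ] Module.End ℚ (CliffordAlgebra (LinearMap.BilinMap.toQuadraticMap P.form)) | ∃ b b' : Module.End ℚ (CliffordAlgebra (LinearMap.BilinMap.toQuadraticMap P.form)), (Submodule.map ((CliffordAlgebra.ι (LinearMap.BilinMap.toQuadraticMap P.form)).baseChange ℂ) (H.piece 2 0) * ⊤).map (b.baseChange ℂ) ≤ (Submodule.map ((CliffordAlgebra.ι (LinearMap.BilinMap.toQuadraticMap P.form)).baseChange ℂ) (H.piece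 2 0) * ⊤) ∧ (Submodule.map ((CliffordAlgebra.ι (LinearMap.BilinMap.toQuadraticMap P.form)).baseChange ℂ) (H.piece 2 0) * ⊤).map (b'.baseChange ℂ) ≤ (Submodule.map ((CliffordAlgebra.ι (LinearMap.BilinMap.toQuadraticMap P.form)).baseChange ℂ) (H.piece 2 0) * ⊤) ∧ ∀ t, ν t = b ∘ₗ LinearMap.mulLeft ℚ ((CliffordAlgebra.ι (LinearMap.BilinMap.toQuadraticMap P.form)) t) ∘ₗ b'}

/-- STUB A1 (size L). [cite: VanGeemen2008RM, §5–6] -/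
theorem stub_absorption_real : AbsorptionReal := by
  sorry

/-- STUB A2 (size L). [cite: vanGeemen2000KugaSatakeHC, §6] -/
theorem stub_absorption_cm : AbsorptionCM := by
  sorry

/-- Composition (sorry-free, verbatim conclusion): excluded middle on "every Hodge endomorphism is
`P`-self-adjoint". [cite: Zarhin1983HodgeGroupsK3, Thm. 1.5.1] -/
theorem twistAbsorption_of_pieces (h₁ : AbsorptionReal) (h₂ : AbsorptionCM) :
    ∀ (T : Type) [AddCommGroup T] [Module ℚ T] [Module.Finite ℚ T] (H : HodgeStructure T 2) (P : H.Polarization), H.F 3 = ⊥ → H.hodgeNumber 2 0 = 1 → (∀ t : T, HodgeStructure.ofRat t ∈ H.F 1 → t = 0) → ∀ e : H.Hom H, (LinearMap.mul ℚ (CliffordAlgebra (LinearMap.BilinMap.toQuadraticMap P.form))).comp ((CliffordAlgebra.ι (LinearMap.BilinMap.toQuadraticMap P.form)).comp e.toLinearMap) ∈ Submodule.span ℚ {ν : T →ₗ[ℚ] Module.End ℚ (CliffordAlgebra (LinearMap.BilinMap.toQuadraticMap P.form)) | ∃ b b' : Module.End ℚ (CliffordAlgebra (LinearMap.BilinMap.toQuadraticMap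 P.form)), (Submodule.map ((CliffordAlgebra.ι (LinearMap.BilinMap.toQuadraticMap P.form)).baseChange ℂ) (H.piece 2 0) * ⊤).map (b.baseChange ℂ) ≤ (Submodule.map ((CliffordAlgebra.ι (LinearMap.BilinMap.toQuadraticMap P.form)).baseChange ℂ) (H.piece 2 0) * ⊤) ∧ (Submodule.map ((CliffordAlgebra.ι (LinearMap.BilinMap.toQuadraticMap P.form)).baseChange ℂ) (H.piece 2 0) * ⊤).map (b'.baseChange ℂ) ≤ (Submodule.map ((CliffordAlgebra.ι (LinearMap.BilinMap.toQuadraticMap P.form)).baseChange ℂ) (H.piece 2 0) * ⊤) ∧ ∀ t, ν t = b ∘ₗ LinearMap.mulLeft ℚ ((CliffordAlgebra.ι (LinearMap.BilinMap.toQuadraticMap P.form)) t) ∘ₗ b'} := by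
  intro T _ _ _ H P hF3 h20 hirr e
  by_cases hadj : ∀ a : H.Hom H, LinearMap.IsAdjointPair P.form P.form a.toLinearMap a.toLinearMap
  · exact h₁ T H P hF3 h20 hirr hadj e
  · push Not at hadj
    exact h₂ T H P hF3 h20 hirr hadj e

/-- **THE SKELETON THEOREM**: the route decl `TwistAbsorption` by name from the two declared stubs.
[cite: Zarhin1983HodgeGroupsK3, Thm. 1.5.1] -/
theorem TwistAbsorption_of : TwistAbsorption :=
  twistAbsorption_of_pieces stub_absorption_real stub_absorption_cm

end Summit.HodgeConjecture.HodgeConjecture.Cruxes.TwistAbsorption.ZarhinDichotomy
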